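import Literature.Probability.RandomPlanarGeometry.HexSAWBrickWallStripFugacityWidthOneContactZigzagLimit
import HarnessLib

/-!
# The zigzag cost off the diagonal: closed form and the exact sector of vanishing at the origin

Child module of `…ContactZigzagLimit` (on the diagonal `y = z` the zigzag cost `log μ₁(y,y) − (log y)/3` tends to `0` as `y → 0⁺`) and
`…ContactPhaseCorners` (#774: the zigzag vertex `(1/6,1/6)` of the closed density triangle costs `Z(y,z) = log μ₁(y,z) − (log y + log z)/6 > 0`).
The sextic law `s(s − y)(s − z) = yz` (`s = μ₁(y,z)²`) gives the cost IN CLOSED FORM for all fugacities and decides the off-diagonal limit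
(DOOR-ap5-g23 item 3):
* §1 ★★ `zigzagCost_eq`: `Z(y,z) = −(1/6)·[log(1 − y/s) + log(1 − z/s)]`; the ratios satisfy `(y/s)³ ≤ y²/z`, `(z/s)³ ≤ z²/y` (`s³ ≥ yz`);
* §2 ★★★ `zigzagCost_lt_of_ratios`: for every `ε > 0` there is `η > 0` with `Z(y,z) < ε` whenever `y²/z ≤ η` and `z²/y ≤ η` — the cost
  VANISHES at the origin throughout the sector between the parabolas `z = y²` and `y = z²` (every power law `z = y^k`, `½ < k < 2`);
* §3 ★★ `zigzagCost_ge_of_le_parabola`: below the parabola, `z ≤ c·y²` with `cy ≤ ½`, the cost stays `≥ (1/6)·log(1 + 1/(2c))`; and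
  ★★ `zigzagCost_ge_log`: for `2z ≤ y`, `Z(y,z) ≥ (1/6)·log(y²/(2z))` — it DIVERGES when `z/y² → 0` (a very repelling top wall cannot be
  compensated: the walk then prefers the bottom row to the zigzag).
So `Z → 0` at the origin exactly in the (log-log) sector `½ < log z/log y < 2`; on its boundary parabolas the cost stays bounded away from
`0`, outside it tends to `+∞`.

## Sources
JansevanRensburg2000 §3.3, §5 (1st ed., OUP 2000); BeatonBousquetMelouDeGierDuminilCopinGuttmann2014 §3.2 Proposition 6 (arXiv v5 p. 10: the
strip `S_1`, `μ_1(y,z)`).  Nothing quoted AS PRINTED; statements are this lineage's.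
-/

noncomputable section

open Filter Topology Finset Literature.Probability.LatticeModels Literature.Probability.Percolation SimpleGraph

namespace Literature.Probability.RandomPlanarGeometry.SAW.HexBW

open WidthOneYZ Real

variable {y z : ℝ}

/-! ## §1 The closed form -/

/-- Basic ratio facts at `s = μ₁(y,z)²`: `0 < y/s < 1`, `0 < z/s < 1`, and `(1 − y/s)(1 − z/s) = yz/s³` (the sextic law divided by `s³`).
[cite: BeatonBousquetMelouDeGierDuminilCopinGuttmann2014, §3.2 Proposition 6 (arXiv v5 p. 10; the tree's sextic law)] -/
theorem zigzag_ratio_facts (hy : 0 < y) (hz : 0 < z) :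
    0 < y / stripMuY₂ 1 y z ^ 2 ∧ y / stripMuY₂ 1 y z ^ 2 < 1 ∧ 0 < z / stripMuY₂ 1 y z ^ 2 ∧ z / stripMuY₂ 1 y z ^ 2 < 1 ∧
      (1 - y / stripMuY₂ 1 y z ^ 2) * (1 - z / stripMuY₂ 1 y z ^ 2) = y * z / (stripMuY₂ 1 y z ^ 2) ^ 3 := by
  set s := stripMuY₂ 1 y z ^ 2 with hs
  have hlaw := stripMuY₂_one_sq_poly_eq hy hz
  have hmax := max_lt_stripMuY₂_one_sq hy hz
  rw [← hs] at hlaw hmax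
  have hsy : y < s := lt_of_le_of_lt (le_max_left _ _) hmax
  have hsz : z < s := lt_of_le_of_lt (le_max_right _ _) hmax
  have hs0 : 0 < s := hy.trans hsy
  refine ⟨div_pos hy hs0, (div_lt_one hs0).2 hsy, div_pos hz hs0, (div_lt_one hs0).2 hsz, ?_⟩
  field_simp
  nlinarith [hlaw]

/-- ★★ **The zigzag cost in closed form**: for all `y, z > 0`,
`log μ₁(y,z) − (log y + log z)/6 = −(1/6)·(log(1 − y/μ₁²) + log(1 − z/μ₁²))` (from `s³/(yz) = 1/((1 − y/s)(1 − z/s))`).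
[cite: BeatonBousquetMelouDeGierDuminilCopinGuttmann2014, §3.2 Proposition 6 (arXiv v5 p. 10); JansevanRensburg2000, §3.3 (1st ed.; lane statement)] -/
theorem zigzagCost_eq (hy : 0 < y) (hz : 0 < z) :
    Real.log (stripMuY₂ 1 y z) - (Real.log y + Real.log z) / 6 =
      -(1 / 6) * (Real.log (1 - y / stripMuY₂ 1 y z ^ 2) + Real.log (1 - z / stripMuY₂ 1 y z ^ 2)) := by
  obtain ⟨hq0, hq1, hr0, hr1, hprod⟩ := zigzag_ratio_facts hy hz
  have hμ := stripMuY₂_pos 1 hy hz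
  set s := stripMuY₂ 1 y z ^ 2 with hs
  have hs0 : 0 < s := by positivity
  have h1q : 0 < 1 - y / s := by linarith
  have h1r : 0 < 1 - z / s := by linarith
  have hlogμ : Real.log (stripMuY₂ 1 y z) = Real.log s / 2 := by
    rw [hs, Real.log_pow]; push_cast; ring
  have hlog : Real.log (1 - y / s) + Real.log (1 - z / s) = Real.log y + Real.log z - 3 * Real.log s := by
    rw [← Real.log_mul h1q.ne' h1r.ne', hprod, Real.log_div (by positivity) (by positivity), Real.log_mul hy.ne' hz.ne',
      Real.log_pow]
    push_cast; ring
  rw [hlogμ, hlog]; ring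

/-- **The ratios are small where the other fugacity is not too small**: `(y/s)³ ≤ y²/z` and `(z/s)³ ≤ z²/y` (from `yz = s(s−y)(s−z) ≤ s³`).
[cite: BeatonBousquetMelouDeGierDuminilCopinGuttmann2014, §3.2 Proposition 6 (arXiv v5 p. 10; lane estimate on the sextic law)] -/
theorem zigzag_ratio_pow_three_le (hy : 0 < y) (hz : 0 < z) :
    (y / stripMuY₂ 1 y z ^ 2) ^ 3 ≤ y ^ 2 / z ∧ (z / stripMuY₂ 1 y z ^ 2) ^ 3 ≤ z ^ 2 / y := by
  set s := stripMuY₂ 1 y z ^ 2 with hs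
  have hlaw := stripMuY₂_one_sq_poly_eq hy hz
  have hmax := max_lt_stripMuY₂_one_sq hy hz
  rw [← hs] at hlaw hmax
  have hsy : y < s := lt_of_le_of_lt (le_max_left _ _) hmax
  have hsz : z < s := lt_of_le_of_lt (le_max_right _ _) hmax
  have hs0 : 0 < s := hy.trans hsy
  -- `yz ≤ s³`
  have hcube : y * z ≤ s ^ 3 := by
    nlinarith [mul_pos hs0 (mul_pos (sub_pos.2 hsy) (sub_pos.2 hsz)), mul_pos hy hz, mul_pos hs0 hy, mul_pos hs0 hz]
  have hs3 : 0 < s ^ 3 := pow_pos hs0 3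
  constructor
  · rw [div_pow, div_le_div_iff₀ hs3 hz]
    calc y ^ 3 * z = y ^ 2 * (y * z) := by ring
      _ ≤ y ^ 2 * s ^ 3 := mul_le_mul_of_nonneg_left hcube (sq_nonneg y)
  · rw [div_pow, div_le_div_iff₀ hs3 hy]
    calc z ^ 3 * y = z ^ 2 * (y * z) := by ring
      _ ≤ z ^ 2 * s ^ 3 := mul_le_mul_of_nonneg_left hcube (sq_nonneg z)

/-! ## §2 The sector of vanishing -/

/-- ★★★ **THE ZIGZAG COST VANISHES IN THE SECTOR BETWEEN THE PARABOLAS**: for every `ε > 0` there is `η > 0` such that for all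
`y, z > 0` with `y² ≤ η·z` and `z² ≤ η·y` the zigzag cost satisfies `log μ₁(y,z) − (log y + log z)/6 < ε`.  In particular the cost tends to
`0` at the origin along every power law `z = y^k` with `½ < k < 2` (the diagonal `k = 1` is `tendsto_zigzagCost_diag_nhdsGT_zero`): two
comparably repelling walls make the zigzag typical.  (`η = (1 − e^{−ε})³` will do.)
[cite: JansevanRensburg2000, §3.3 and §5 (1st ed.; lane statement); BeatonBousquetMelouDeGierDuminilCopinGuttmann2014, §3.2 Proposition 6 (arXiv v5 p. 10)] -/
theorem zigzagCost_lt_of_ratios {ε : ℝ} (hε : 0 < ε) :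
    ∃ η : ℝ, 0 < η ∧ ∀ {y z : ℝ}, 0 < y → 0 < z → y ^ 2 ≤ η * z → z ^ 2 ≤ η * y →
      Real.log (stripMuY₂ 1 y z) - (Real.log y + Real.log z) / 6 < ε := by
  set δ := 1 - Real.exp (-ε) with hδ
  have hδ0 : 0 < δ := by
    have : Real.exp (-ε) < Real.exp 0 := Real.exp_lt_exp.2 (by linarith)
    rw [Real.exp_zero] at this
    rw [hδ]; linarith
  have hδ1 : δ < 1 := by rw [hδ]; linarith [Real.exp_pos (-ε)]
  refine ⟨δ ^ 3, pow_pos hδ0 3, fun {y z} hy hz hyz hzy => ?_⟩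
  obtain ⟨hq0, hq1, hr0, hr1, -⟩ := zigzag_ratio_facts hy hz
  obtain ⟨hq3, hr3⟩ := zigzag_ratio_pow_three_le hy hz
  set q := y / stripMuY₂ 1 y z ^ 2 with hq
  set r := z / stripMuY₂ 1 y z ^ 2 with hr
  -- `q³ ≤ y²/z ≤ δ³`, hence `q ≤ δ`; same for `r`
  have hq3' : q ^ 3 ≤ δ ^ 3 := hq3.trans (by rw [div_le_iff₀ hz]; exact hyz)
  have hr3' : r ^ 3 ≤ δ ^ 3 := hr3.trans (by rw [div_le_iff₀ hy]; exact hzy)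
  have hqδ : q ≤ δ := (pow_le_pow_iff_left₀ hq0.le hδ0.le three_ne_zero).1 hq3'
  have hrδ : r ≤ δ := (pow_le_pow_iff_left₀ hr0.le hδ0.le three_ne_zero).1 hr3'
  -- `−log(1 − q) ≤ ε`
  have hlq : -ε ≤ Real.log (1 - q) := by
    have h : Real.exp (-ε) ≤ 1 - q := by rw [hδ] at hqδ; linarith
    have := Real.log_le_log (Real.exp_pos _) h
    rwa [Real.log_exp] at this
  have hlr : -ε ≤ Real.log (1 - r) := by
    have h : Real.exp (-ε) ≤ 1 - r := by rw [hδ] at hrδ; linarith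
    have := Real.log_le_log (Real.exp_pos _) h
    rwa [Real.log_exp] at this
  rw [zigzagCost_eq hy hz]
  change -(1 / 6) * (Real.log (1 - q) + Real.log (1 - r)) < ε
  nlinarith

/-! ## §3 Outside the sector: the cost stays positive, and diverges -/

/-- A one-sided lower bound valid everywhere: `Z(y,z) ≥ −(1/6)·log(1 − y/μ₁²)` (the other logarithm is `≤ 0`).
[cite: JansevanRensburg2000, §3.3 (1st ed.; lane statement); BeatonBousquetMelouDeGierDuminilCopinGuttmann2014, §3.2 Proposition 6 (arXiv v5 p. 10)] -/
theorem zigzagCost_ge_left (hy : 0 < y) (hz : 0 < z) :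
    -(1 / 6) * Real.log (1 - y / stripMuY₂ 1 y z ^ 2) ≤ Real.log (stripMuY₂ 1 y z) - (Real.log y + Real.log z) / 6 := by
  obtain ⟨hq0, hq1, hr0, hr1, -⟩ := zigzag_ratio_facts hy hz
  have hlr0 : Real.log (1 - z / stripMuY₂ 1 y z ^ 2) ≤ 0 := Real.log_nonpos (by linarith) (by linarith)
  rw [zigzagCost_eq hy hz]
  nlinarith

/-- ★★ **Below the parabola the cost does not vanish**: if `z ≤ c·y²` with `c > 0` and `c·y ≤ ½` then
`log μ₁(y,z) − (log y + log z)/6 ≥ (1/6)·log(1 + 1/(2c))` (the tree's phase-portrait bound `s − y ≤ 2z/y` for `2z ≤ y` gives `y/s ≥ 1/(1+2c)`).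
So along `z = c·y² → 0` the zigzag cost stays above a positive constant.
[cite: JansevanRensburg2000, §3.3 and §5 (1st ed.; lane statement); BeatonBousquetMelouDeGierDuminilCopinGuttmann2014, §3.2 Proposition 6 (arXiv v5 p. 10)] -/
theorem zigzagCost_ge_of_le_parabola (hy : 0 < y) (hz : 0 < z) {c : ℝ} (hc : 0 < c) (hzc : z ≤ c * y ^ 2) (hcy : c * y ≤ 1 / 2) :
    (1 / 6) * Real.log (1 + 1 / (2 * c)) ≤ Real.log (stripMuY₂ 1 y z) - (Real.log y + Real.log z) / 6 := by
  obtain ⟨hq0, hq1, -, -, -⟩ := zigzag_ratio_facts hy hz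
  set s := stripMuY₂ 1 y z ^ 2 with hs
  have hs0 : 0 < s := by
    have := stripMuY₂_pos 1 hy hz; positivity
  -- `2z ≤ y`
  have h2z : 2 * z ≤ y := by nlinarith
  have hsub : s - y ≤ 2 * z / y := (stripMuY₂_one_sq_sub_le' hy hz).2 h2z
  -- `s ≤ y (1 + 2c)`
  have hs_le : s ≤ y * (1 + 2 * c) := by
    have : 2 * z / y ≤ 2 * c * y := by
      rw [div_le_iff₀ hy]; nlinarith
    nlinarith
  -- `1 − y/s ≤ 1 − 1/(1+2c) = 2c/(1+2c) = 1/(1 + 1/(2c))`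
  have h12c : 0 < 1 + 2 * c := by linarith
  have hys : 1 / (1 + 2 * c) ≤ y / s := by
    rw [div_le_div_iff₀ h12c hs0]; linarith
  have hkey : 1 - y / s ≤ 1 / (1 + 1 / (2 * c)) := by
    have e : 1 / (1 + 1 / (2 * c)) = 1 - 1 / (1 + 2 * c) := by field_simp; ring
    rw [e]; linarith
  have hpos : 0 < 1 - y / s := by linarith
  have hlog : Real.log (1 - y / s) ≤ -Real.log (1 + 1 / (2 * c)) := by
    have := Real.log_le_log hpos hkey
    rwa [Real.log_div one_ne_zero (by positivity), Real.log_one, zero_sub] at this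
  have h := zigzagCost_ge_left hy hz
  rw [← hs] at h
  nlinarith

/-- ★★ **Divergence beyond the parabola**: for `2z ≤ y`, `log μ₁(y,z) − (log y + log z)/6 ≥ (1/6)·log(y²/(2z))` — so the zigzag cost tends
to `+∞` whenever `z/y² → 0` (e.g. `z = y^k`, `k > 2`, `y → 0⁺`): with a much more repelling top wall the cheap configuration is the bottom
row, not the zigzag. [cite: JansevanRensburg2000, §3.3 and §5 (1st ed.; lane statement); BeatonBousquetMelouDeGierDuminilCopinGuttmann2014, §3.2 Proposition 6 (arXiv v5 p. 10)] -/
theorem zigzagCost_ge_log (hy : 0 < y) (hz : 0 < z) (h2z : 2 * z ≤ y) :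
    (1 / 6) * Real.log (y ^ 2 / (2 * z)) ≤ Real.log (stripMuY₂ 1 y z) - (Real.log y + Real.log z) / 6 := by
  obtain ⟨hq0, hq1, -, -, -⟩ := zigzag_ratio_facts hy hz
  set s := stripMuY₂ 1 y z ^ 2 with hs
  have hs0 : 0 < s := by
    have := stripMuY₂_pos 1 hy hz; positivity
  have hsy : y < s := by
    have h := (div_lt_one hs0).1 hq1; exact h
  have hsub : s - y ≤ 2 * z / y := (stripMuY₂_one_sq_sub_le' hy hz).2 h2z
  -- `1 − y/s = (s − y)/s ≤ (2z/y)/y = 2z/y²`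
  have hkey : 1 - y / s ≤ 2 * z / y ^ 2 := by
    have e : 1 - y / s = (s - y) / s := by field_simp
    rw [e, div_le_div_iff₀ hs0 (by positivity)]
    have : (s - y) * y ^ 2 ≤ (2 * z / y) * y ^ 2 := mul_le_mul_of_nonneg_right hsub (sq_nonneg y)
    have e2 : (2 * z / y) * y ^ 2 = 2 * z * y := by field_simp
    rw [e2] at this
    nlinarith
  have hpos : 0 < 1 - y / s := by linarith
  have hlog : Real.log (1 - y / s) ≤ -Real.log (y ^ 2 / (2 * z)) := by
    have := Real.log_le_log hpos hkey
    have e : Real.log (2 * z / y ^ 2) = -Real.log (y ^ 2 / (2 * z)) := by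
      rw [← Real.log_inv]; congr 1; field_simp
    rwa [e] at this
  have h := zigzagCost_ge_left hy hz
  rw [← hs] at h
  nlinarith

/-- ★★ **The mirror statements** (walls swapped, `μ₁(y,z) = μ₁(z,y)`): above the parabola `y = c·z²` the cost stays
`≥ (1/6)·log(1 + 1/(2c))`, and for `2y ≤ z` it is `≥ (1/6)·log(z²/(2y))`.
[cite: JansevanRensburg2000, §3.3 and §5 (1st ed.; lane statement); BeatonBousquetMelouDeGierDuminilCopinGuttmann2014, §3.2 Proposition 6 (arXiv v5 p. 10)] -/
theorem zigzagCost_ge_of_le_parabola' (hy : 0 < y) (hz : 0 < z) :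
    (∀ {c : ℝ}, 0 < c → y ≤ c * z ^ 2 → c * z ≤ 1 / 2 →
      (1 / 6) * Real.log (1 + 1 / (2 * c)) ≤ Real.log (stripMuY₂ 1 y z) - (Real.log y + Real.log z) / 6) ∧
    (2 * y ≤ z → (1 / 6) * Real.log (z ^ 2 / (2 * y)) ≤ Real.log (stripMuY₂ 1 y z) - (Real.log y + Real.log z) / 6) := by
  constructor
  · intro c hc hyc hcz
    have h := zigzagCost_ge_of_le_parabola hz hy hc hyc hcz
    rw [stripMuY₂_symm 1 z y] at h
    linarith
  · intro h2y
    have h := zigzagCost_ge_log hz hy h2y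
    rw [stripMuY₂_symm 1 z y] at h
    linarith

end Literature.Probability.RandomPlanarGeometry.SAW.HexBW
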